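import Literature.Probability.RandomPlanarGeometry.SelfAvoidingWalk
import Literature.Probability.RandomPlanarGeometry.JordanIndex
import HarnessLib

/-!
# The side (left-passage) loop and side probability of the critical planar SAW

Topic `Literature/Probability/RandomPlanarGeometry`; definition request `defn-SAWSideProbability`
of route CriticalPhenomena/SAWScalingLimit/SAWSchrammPassage (items `TurningClosure`
stmt-CriticalPhenomena-5595, `SchrammPassageUniform` stmt-5596, `SchrammPassage` stmt-5599, which
inline the loop as a `let L := …` prefix).

Schramm's percolation-formula observable for the self-avoiding walk (Schramm 2001, Thm. 2 at
`κ = 8/3`; Kennedy's simulations): the probability that a point `z` of a Dobrushin domain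
`(D; a, b)` lies on a given SIDE of the critical SAW `γ` from (a lattice approximation `u` of)
`a = D.pt 0` to (`v` of) `b = D.pt 1`.  "Side" is made precise by a WINDING NUMBER: close the
mesh polyline of `γ` up into a loop by running from its tip `δ v` straight to `b`, then along the
boundary arc number `1` of `D` (from `b = boundary (mark 1)` to `a = boundary (mark 0 + 1)`), then
straight from `a` back to `δ u`; `z` is on the arc-`1` side iff this loop winds non-trivially
about `z`.

* `SAW.sideLoop D δ u v γ : ℝ → ℂ` — that closed loop, parametrised by `[0, 1]` in four pieces
  (`[0, ½]` polyline at double speed, then three thirds of `[½, 1]`: segment, boundary arc,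
  segment) — VERBATIM the route's inline `let L := fun γ t => …` (`sideLoop_def` is `rfl`);
* `SAW.sideProb D δ u v z : ℝ` — `P_δ[wind(sideLoop γ - z) ≠ 0]` under the critical SAW law
  `SAW.law D.carrier δ u v` (`SelfAvoidingWalk.lean`), as a real number (`toReal`; the law has
  total mass `≤ 1`, `= 1` as soon as a SAW from `u` to `v` exists).

API (all proved): the values of the loop at the four junctions (`sideLoop_zero`, `sideLoop_half`,
`sideLoop_two_thirds`, `sideLoop_five_sixths`, `sideLoop_one`), closedness
`sideLoop_zero_eq_sideLoop_one`, CONTINUITY `continuous_sideLoop` (the four pieces match at the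
junctions: tip of the polyline `= δ v`, `D.pt 1 = boundary (mark 1)`, periodicity
`boundary (mark 0 + 1) = boundary (mark 0) = D.pt 0`), `SAW.law_apply_le_one`,
`sideProb_nonneg`, `sideProb_le_one`, and the general polyline fact
`SimpleGraph.Walk.toCurve_apply_one` (a walk's curve ends at its embedded endpoint).

What is NOT here (requested API beyond a definition file): `wind ∈ {0, D.index z}` for `z` off
the trace, the domain-Markov / tower identity of `sideProb` under conditioning on an initial
segment, the face-Laplacian (turning) identity, and the continuum target
`(1 - D.index z · cos arg Φ⁻¹ z)/2` (Schramm 2001, Thm. 2) — facts/theorems for the route's items.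
-/

noncomputable section

open Set Literature.Probability.LatticeModels Literature.Topology.PlaneTopology

/-! ### A walk's polyline ends at its endpoint -/

namespace SimpleGraph.Walk

variable {V E : Type*} [AddCommGroup E] [Module ℝ E] [TopologicalSpace E] [ContinuousAdd E]
  [ContinuousSMul ℝ E] {G : SimpleGraph V} {u v : V}

/-- The curve of a walk ends at the (embedded) final vertex (companion of `toCurve_apply_zero`;
a deliberate dot-notation extension of Mathlib's `SimpleGraph.Walk` namespace, as in
`LatticeInterface.lean`). (Camia–Newman 2007, §2.) [cite: CamiaNewman2007, §2] -/
@[simp] theorem toCurve_apply_one (emb : V → E) (w : G.Walk u v) : w.toCurve emb 1 = emb v := by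
  have hs : w.support.map emb = emb u :: w.support.tail.map emb := by
    rw [← w.cons_tail_support, List.map_cons, List.tail_cons]
  have hlast : (emb u :: w.support.tail.map emb).getLast (by simp) = emb v := by
    have h1 : (w.support.map emb).getLast (by simp) = emb v := by
      rw [List.getLast_map, SimpleGraph.Walk.getLast_support]
    simpa only [hs] using h1
  change polyline (w.support.map emb) 1 = emb v
  rw [hs, polyline_apply_one, hlast]

end SimpleGraph.Walk

namespace Literature.Probability.RandomPlanarGeometry

namespace SAW

variable (D : DobrushinDomain) (δ : ℝ) (u v : Site 2)

/-! ### The side loop -/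

/-- The SIDE LOOP of the SAW `γ` from `u` to `v` in the Dobrushin domain `D` at mesh `δ`: the closed
curve on `[0, 1]` which runs along the mesh polyline of `γ` on `[0, ½]` (at double speed), then
on the three thirds of `[½, 1]` along the segment from the tip `δ v` to `b = D.pt 1`, along the
boundary arc `1` of `D` (parameters from `D.mark 1` to `D.mark 0 + 1`) back to `a = D.pt 0`, and
along the segment from `a` to `δ u`.  Verbatim the inline `let L := …` of the items of route
SAWSchrammPassage (`sideLoop_def`).  Its winding number about `z` decides on which side of `γ`
the point `z` lies (Schramm's left-passage event). [cite: Schramm2001Percolation, Thm. 2] -/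
def sideLoop (γ : DomainSAW D.carrier δ u v) : ℝ → ℂ := fun t =>
  if t ≤ 1 / 2 then (γ.walk.toCurve (meshPoint δ)) (Set.projIcc (0 : ℝ) 1 zero_le_one (2 * t))
  else if 2 * t - 1 ≤ 1 / 3 then
    meshPoint δ v + ((3 * (2 * t - 1) : ℝ) : ℂ) * (D.pt 1 - meshPoint δ v)
  else if 2 * t - 1 ≤ 2 / 3 then
    D.boundary (D.mark 1 + (3 * (2 * t - 1) - 1) * (D.mark 0 + 1 - D.mark 1))
  else D.pt 0 + ((3 * (2 * t - 1) - 2 : ℝ) : ℂ) * (meshPoint δ u - D.pt 0)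

/-- Unfolding `sideLoop` to the route's inline `let L := fun γ t => …` (definitionally).
[cite: Schramm2001Percolation, Thm. 2] -/
theorem sideLoop_def : sideLoop D δ u v = fun γ t =>
    if t ≤ 1 / 2 then (γ.walk.toCurve (meshPoint δ)) (Set.projIcc (0 : ℝ) 1 zero_le_one (2 * t))
    else if 2 * t - 1 ≤ 1 / 3 then
      meshPoint δ v + ((3 * (2 * t - 1) : ℝ) : ℂ) * (D.pt 1 - meshPoint δ v)
    else if 2 * t - 1 ≤ 2 / 3 then
      D.boundary (D.mark 1 + (3 * (2 * t - 1) - 1) * (D.mark 0 + 1 - D.mark 1))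
    else D.pt 0 + ((3 * (2 * t - 1) - 2 : ℝ) : ℂ) * (meshPoint δ u - D.pt 0) :=
  rfl

variable {D δ u v}
variable (γ : DomainSAW D.carrier δ u v)

/-- On `[0, ½]` the side loop is the mesh polyline of the walk at double speed. [folklore] -/
theorem sideLoop_apply_of_le_half {t : ℝ} (ht : t ≤ 1 / 2) :
    sideLoop D δ u v γ t =
      (γ.walk.toCurve (meshPoint δ)) (Set.projIcc (0 : ℝ) 1 zero_le_one (2 * t)) :=
  if_pos ht

/-- The side loop starts at the mesh point of `u`. [folklore] -/
@[simp] theorem sideLoop_zero : sideLoop D δ u v γ 0 = meshPoint δ u := by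
  rw [sideLoop_apply_of_le_half γ (by norm_num), mul_zero, Set.projIcc_left]
  exact γ.walk.toCurve_apply_zero (meshPoint δ)

/-- At `t = ½` the side loop is at the tip `δ v` of the walk. [folklore] -/
@[simp] theorem sideLoop_half : sideLoop D δ u v γ (1 / 2) = meshPoint δ v := by
  rw [sideLoop_apply_of_le_half γ le_rfl, show (2 : ℝ) * (1 / 2) = 1 by norm_num,
    Set.projIcc_right]
  exact γ.walk.toCurve_apply_one (meshPoint δ)

/-- At `t = ⅔` (end of the first segment) the side loop is at `b = D.pt 1`. [folklore] -/
@[simp] theorem sideLoop_two_thirds : sideLoop D δ u v γ (2 / 3) = D.pt 1 := by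
  simp only [sideLoop, show ¬ ((2 : ℝ) / 3 ≤ 1 / 2) by norm_num,
    show (2 : ℝ) * (2 / 3) - 1 ≤ 1 / 3 by norm_num, if_false, if_true]
  norm_num

/-- At `t = ⅚` (end of the boundary arc) the side loop is at `a = D.pt 0` (periodicity of the
boundary parametrisation: `boundary (mark 0 + 1) = boundary (mark 0)`). [folklore] -/
@[simp] theorem sideLoop_five_sixths : sideLoop D δ u v γ (5 / 6) = D.pt 0 := by
  simp only [sideLoop, show ¬ ((5 : ℝ) / 6 ≤ 1 / 2) by norm_num,
    show ¬ ((2 : ℝ) * (5 / 6) - 1 ≤ 1 / 3) by norm_num,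
    show (2 : ℝ) * (5 / 6) - 1 ≤ 2 / 3 by norm_num,
    if_false, if_true]
  rw [show D.mark 1 + (3 * (2 * (5 / 6 : ℝ) - 1) - 1) * (D.mark 0 + 1 - D.mark 1) = D.mark 0 + 1 by
    ring, D.periodic_boundary]
  rfl

/-- The side loop ends where it started, at the mesh point of `u`. [folklore] -/
@[simp] theorem sideLoop_one : sideLoop D δ u v γ 1 = meshPoint δ u := by
  simp only [sideLoop, show ¬ ((1 : ℝ) ≤ 1 / 2) by norm_num,
    show ¬ ((2 : ℝ) * 1 - 1 ≤ 1 / 3) by norm_num, show ¬ ((2 : ℝ) * 1 - 1 ≤ 2 / 3) by norm_num,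
    if_false]
  push_cast
  ring

/-- The side loop is CLOSED: `sideLoop 0 = sideLoop 1`. [folklore] -/
theorem sideLoop_zero_eq_sideLoop_one : sideLoop D δ u v γ 0 = sideLoop D δ u v γ 1 := by
  rw [sideLoop_zero, sideLoop_one]

/-- The side loop is CONTINUOUS (on all of `ℝ`): the four pieces are continuous and agree at the
junctions `t = ½` (tip of the polyline `= δ v`), `t = ⅔` (`D.pt 1 = boundary (mark 1)`) and
`t = ⅚` (`boundary (mark 0 + 1) = boundary (mark 0) = D.pt 0`). [folklore] -/
theorem continuous_sideLoop : Continuous (sideLoop D δ u v γ) := by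
  have h1 : Continuous fun t : ℝ =>
      (γ.walk.toCurve (meshPoint δ)) (Set.projIcc (0 : ℝ) 1 zero_le_one (2 * t)) :=
    (γ.walk.toCurve (meshPoint δ)).continuous.comp
      (continuous_projIcc.comp (continuous_const.mul continuous_id))
  have h2 : Continuous fun t : ℝ =>
      meshPoint δ v + ((3 * (2 * t - 1) : ℝ) : ℂ) * (D.pt 1 - meshPoint δ v) := by fun_prop
  have h3 : Continuous fun t : ℝ =>
      D.boundary (D.mark 1 + (3 * (2 * t - 1) - 1) * (D.mark 0 + 1 - D.mark 1)) :=
    D.continuous_boundary.comp (by fun_prop)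
  have h4 : Continuous fun t : ℝ =>
      D.pt 0 + ((3 * (2 * t - 1) - 2 : ℝ) : ℂ) * (meshPoint δ u - D.pt 0) := by fun_prop
  have h34 : Continuous fun t : ℝ => if 2 * t - 1 ≤ 2 / 3 then
      D.boundary (D.mark 1 + (3 * (2 * t - 1) - 1) * (D.mark 0 + 1 - D.mark 1))
      else D.pt 0 + ((3 * (2 * t - 1) - 2 : ℝ) : ℂ) * (meshPoint δ u - D.pt 0) := by
    refine Continuous.if_le h3 h4 (by fun_prop) continuous_const fun t ht => ?_
    rw [ht,
      show D.mark 1 + (3 * (2 / 3 : ℝ) - 1) * (D.mark 0 + 1 - D.mark 1) = D.mark 0 + 1 by ring,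
      D.periodic_boundary]
    change D.pt 0 = _
    norm_num
  have h234 : Continuous fun t : ℝ => if 2 * t - 1 ≤ 1 / 3 then
      meshPoint δ v + ((3 * (2 * t - 1) : ℝ) : ℂ) * (D.pt 1 - meshPoint δ v)
      else if 2 * t - 1 ≤ 2 / 3 then
        D.boundary (D.mark 1 + (3 * (2 * t - 1) - 1) * (D.mark 0 + 1 - D.mark 1))
      else D.pt 0 + ((3 * (2 * t - 1) - 2 : ℝ) : ℂ) * (meshPoint δ u - D.pt 0) := by
    refine Continuous.if_le h2 h34 (by fun_prop) continuous_const fun t ht => ?_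
    rw [ht, if_pos (by norm_num)]
    rw [show D.mark 1 + (3 * (1 / 3 : ℝ) - 1) * (D.mark 0 + 1 - D.mark 1) = D.mark 1 by ring]
    change _ = D.pt 1
    push_cast
    ring
  refine Continuous.if_le h1 h234 continuous_id continuous_const fun t ht => ?_
  rw [ht, if_pos (by norm_num), show (2 : ℝ) * (1 / 2) = 1 by norm_num, Set.projIcc_right]
  exact (γ.walk.toCurve_apply_one (meshPoint δ)).trans (by push_cast; ring)

/-! ### The side probability -/

/-- The critical SAW law has total mass at most `1` on every event (it is the normalised weight,
with junk value `0` when no SAW from `u` to `v` exists). [folklore] -/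
theorem law_apply_le_one (Ω : Set ℂ) (δ : ℝ) (a b : Site 2) (S : Set (DomainSAW Ω δ a b)) :
    law Ω δ a b S ≤ 1 := by
  rw [law, MeasureTheory.Measure.smul_apply, smul_eq_mul]
  exact (mul_le_mul' le_rfl (MeasureTheory.measure_mono (μ := weight Ω δ a b)
    (Set.subset_univ S))).trans (ENNReal.inv_mul_le_one _)

variable (D δ u v)

/-- The SIDE PROBABILITY (Schramm's left-passage observable for the SAW) of the point `z`:
`P_δ[wind(sideLoop γ - z) ≠ 0]`, the probability under the critical SAW law from `u` to `v` in
`D_δ` that the side loop of the walk winds non-trivially about `z`, i.e. that `z` lies on the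
arc-`1` side of the walk (for `z` in the domain off the lattice trace the winding number is `0` or
`D.index z = ±1`).  As a real number (`ENNReal.toReal`).  The route's `H f` is
`sideProb D δ p q (c f)`. [cite: Schramm2001Percolation, Thm. 2] -/
def sideProb (z : ℂ) : ℝ :=
  (law D.carrier δ u v {γ | wind (fun t => sideLoop D δ u v γ t - z) ≠ 0}).toReal

/-- Unfolding `sideProb`. [cite: Schramm2001Percolation, Thm. 2] -/
theorem sideProb_def (z : ℂ) : sideProb D δ u v z =
    (law D.carrier δ u v {γ | wind (fun t => sideLoop D δ u v γ t - z) ≠ 0}).toReal :=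
  rfl

/-- `0 ≤ sideProb`. [folklore] -/
theorem sideProb_nonneg (z : ℂ) : 0 ≤ sideProb D δ u v z :=
  ENNReal.toReal_nonneg

/-- `sideProb ≤ 1`. [folklore] -/
theorem sideProb_le_one (z : ℂ) : sideProb D δ u v z ≤ 1 :=
  ENNReal.toReal_le_of_le_ofReal zero_le_one (by simpa using law_apply_le_one D.carrier δ u v _)

/-- `sideProb ∈ [0, 1]`. [folklore] -/
theorem sideProb_mem_Icc (z : ℂ) : sideProb D δ u v z ∈ Set.Icc (0 : ℝ) 1 :=
  ⟨sideProb_nonneg D δ u v z, sideProb_le_one D δ u v z⟩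

end SAW

end Literature.Probability.RandomPlanarGeometry

end
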